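import Mathlib
import Summits.PneNP.PneNP.Theses.OneSlice
import Summits.PneNP.PneNP.Theorems.OneSliceSliceTargetSplit
import Summits.PneNP.PneNP.Theorems.OneSliceMonotoneContinuationDefs
import Summits.PneNP.PneNP.Theorems.OneSliceMonotoneContinuationTowerDown

/-!
# Route OneSlice, crux `MonotoneContinuation` (stmt-PneNP-18471), line `Sketch_ideator1_r1` (ProfileLine) — sub-goal `chain_constancy_down`

CHAIN CONSTANCY OF THE ROUNDED TRANSPORT, DOWNWARD (Markov on the tower identity). Write
`ĝ := transport j (ind f) ∈ [0,1]` for the slice-`j` transport of the indicator of `f` and `G(y) := [1/2 ≤ ĝ(y)]`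
for its rounding. For `y` of edge count `s` and `j ≤ r ≤ s`, the downward neighbourhood `nbhd r y` is the
(nonempty) family of `r`-subsets `u` of `supp y`, and the landed tower identity `transport_tower_down` says that
`ĝ(y)` is the average of `ĝ(u)` over `u ∈ nbhd r y`. Markov's inequality then bounds the fraction of
`u ∈ nbhd r y` whose rounding differs from `G(y)`:
* if `ĝ(y) < 1/2` the differing `u` are those with `ĝ(u) ≥ 1/2`, and `#{u : ĝ(u) ≥ 1/2}·(1/2) ≤ Σ_u ĝ(u) = #nbhd·ĝ(y)`,
  so the fraction is `≤ 2ĝ(y) = 2·min(ĝ(y), 1 − ĝ(y))`;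
* if `ĝ(y) ≥ 1/2` the differing `u` have `1 − ĝ(u) > 1/2`, and `Σ_u (1 − ĝ(u)) = #nbhd·(1 − ĝ(y))`, so the fraction
  is `≤ 2(1 − ĝ(y)) = 2·min(ĝ(y), 1 − ĝ(y))`.
Summing over `y ∈ slice n s` gives the registered statement (with the weaker constant `4`).
-/

set_option linter.dupNamespace false -- `Summit.PneNP.PneNP.…`: summit = sub-problem (D-0017)

namespace Summit.PneNP.PneNP.Theorems.MonotoneContinuation

open Literature.Computability.Complexity hiding supp mem_supp
open Finset hiding slice
open Classical
open Summit.PneNP.PneNP.Theorems.ConstantBand.Negative (Edge slice)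
open Summit.PneNP.PneNP.Theorems.SliceTargetSplit (nbhd mem_nbhd transport ind card_nbhd_of_le transport_ind_mem)

noncomputable section

variable {n : ℕ}

/-- **Markov for a rounded average.** If `g` takes values in `[0,1]` on a nonempty finite set `S` and
`a ∈ [0,1]` is the average of `g` over `S`, then the fraction of `u ∈ S` at which the rounding `[1/2 ≤ g u]`
differs from the rounding `[1/2 ≤ a]` is at most `4·min(a, 1 − a)` (Markov's inequality applied to `g`,
resp. to `1 − g`). [folklore] -/
theorem chainConstancy_markov {α : Type*} (S : Finset α) (g : α → ℝ) (a : ℝ)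
    (hg0 : ∀ u ∈ S, 0 ≤ g u) (hg1 : ∀ u ∈ S, g u ≤ 1) (hS : 0 < #S) (ha0 : 0 ≤ a) (ha1 : a ≤ 1)
    (ha : a = (∑ u ∈ S, g u) / #S) :
    (#(S.filter fun u => decide ((1 : ℝ) / 2 ≤ g u) ≠ decide ((1 : ℝ) / 2 ≤ a)) : ℝ) / #S
      ≤ 4 * min a (1 - a) := by
  have hSpos : (0 : ℝ) < #S := by exact_mod_cast hS
  -- the average identity without division
  have hsum : ∑ u ∈ S, g u = a * #S := by
    rw [ha]; exact (div_mul_cancel₀ _ hSpos.ne').symm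
  rw [div_le_iff₀ hSpos]
  by_cases hay : (1 : ℝ) / 2 ≤ a
  · -- rounding of `a` is `true`; the differing `u` have `g u < 1/2`, i.e. `1 - g u > 1/2`
    have hM : (#(S.filter fun u => decide ((1 : ℝ) / 2 ≤ g u) ≠ decide ((1 : ℝ) / 2 ≤ a)) : ℝ) * (1 / 2)
        ≤ #S - a * #S := by
      calc (#(S.filter fun u => decide ((1 : ℝ) / 2 ≤ g u) ≠ decide ((1 : ℝ) / 2 ≤ a)) : ℝ) * (1 / 2)
          = ∑ _u ∈ S.filter (fun u => decide ((1 : ℝ) / 2 ≤ g u) ≠ decide ((1 : ℝ) / 2 ≤ a)), (1 / 2 : ℝ) := by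
            rw [sum_const, nsmul_eq_mul]
        _ ≤ ∑ u ∈ S.filter (fun u => decide ((1 : ℝ) / 2 ≤ g u) ≠ decide ((1 : ℝ) / 2 ≤ a)), (1 - g u) := by
            refine sum_le_sum fun u hu => ?_
            have hne := (mem_filter.1 hu).2
            rw [decide_eq_true hay] at hne
            have hgu : ¬ ((1 : ℝ) / 2 ≤ g u) := fun h => hne (decide_eq_true h)
            push Not at hgu
            linarith
        _ ≤ ∑ u ∈ S, (1 - g u) :=
            sum_le_sum_of_subset_of_nonneg (filter_subset _ _) fun u hu _ => sub_nonneg.2 (hg1 u hu)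
        _ = #S - a * #S := by
            rw [sum_sub_distrib, sum_const, nsmul_eq_mul, mul_one, hsum]
    have hprod : 0 ≤ (1 - a) * (#S : ℝ) := mul_nonneg (sub_nonneg.2 ha1) hSpos.le
    rw [min_eq_right (by linarith)]
    nlinarith [hM, hprod]
  · -- rounding of `a` is `false`; the differing `u` have `1/2 ≤ g u`
    push Not at hay
    have hM : (#(S.filter fun u => decide ((1 : ℝ) / 2 ≤ g u) ≠ decide ((1 : ℝ) / 2 ≤ a)) : ℝ) * (1 / 2)
        ≤ a * #S := by
      calc (#(S.filter fun u => decide ((1 : ℝ) / 2 ≤ g u) ≠ decide ((1 : ℝ) / 2 ≤ a)) : ℝ) * (1 / 2)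
          = ∑ _u ∈ S.filter (fun u => decide ((1 : ℝ) / 2 ≤ g u) ≠ decide ((1 : ℝ) / 2 ≤ a)), (1 / 2 : ℝ) := by
            rw [sum_const, nsmul_eq_mul]
        _ ≤ ∑ u ∈ S.filter (fun u => decide ((1 : ℝ) / 2 ≤ g u) ≠ decide ((1 : ℝ) / 2 ≤ a)), g u := by
            refine sum_le_sum fun u hu => ?_
            have hne := (mem_filter.1 hu).2
            rw [decide_eq_false (not_le.2 hay)] at hne
            by_contra hgu
            exact hne (decide_eq_false hgu)
        _ ≤ ∑ u ∈ S, g u := sum_le_sum_of_subset_of_nonneg (filter_subset _ _) fun u hu _ => hg0 u hu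
        _ = a * #S := hsum
    have hprod : 0 ≤ a * (#S : ℝ) := mul_nonneg ha0 hSpos.le
    rw [min_eq_left (by linarith)]
    nlinarith [hM, hprod]

/-- **Chain constancy** (sub-goal `chain_constancy_down` of the line `Sketch_ideator1_r1`; Markov on the tower
identity): for `j ≤ r ≤ s ≤ C(n,2)`, summed over the level `s`, the fraction of `r`-subsets `u ∈ nbhd r y` of a
level-`s` point `y` whose rounded slice-`j` transport `[1/2 ≤ ĝ(u)]` differs from `[1/2 ≤ ĝ(y)]`
(`ĝ = transport j (ind f)`) is at most `4·Σ_{y ∈ slice s} min(ĝ(y), 1 − ĝ(y))`. [folklore] -/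
theorem chain_constancy_down :
  ∀ (n j r s : ℕ) (f : (Edge n → Bool) → Bool), j ≤ r → r ≤ s → s ≤ n.choose 2 →
    (∑ y ∈ slice n s, (#((nbhd r y).filter fun u =>
        decide ((1 : ℝ) / 2 ≤ transport j (ind f) u) ≠ decide ((1 : ℝ) / 2 ≤ transport j (ind f) y)) : ℝ) / #(nbhd r y))
      ≤ 4 * ∑ y ∈ slice n s, min (transport j (ind f) y) (1 - transport j (ind f) y) := by
  intro n j r s f hjr hrs _
  rw [mul_sum]
  refine sum_le_sum fun y hy => ?_
  have hys : edgeCount y = s := (mem_filter.1 hy).2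
  have hry : r ≤ edgeCount y := by rw [hys]; exact hrs
  have hcard : 0 < #(nbhd r y) := by rw [card_nbhd_of_le hry]; exact Nat.choose_pos hry
  exact chainConstancy_markov (nbhd r y) (transport j (ind f)) (transport j (ind f) y)
    (fun u _ => (transport_ind_mem f u).1) (fun u _ => (transport_ind_mem f u).2) hcard
    (transport_ind_mem f y).1 (transport_ind_mem f y).2 (transport_tower_down n j r (ind f) y hjr hry)

end

end Summit.PneNP.PneNP.Theorems.MonotoneContinuation
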